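import Summits.CriticalPhenomena.PercolationContinuityZ3.Theorems.PercNearOneGluingNoHeavyLowerTailHullPortSelectionThree
import HarnessLib

/-!
# `NoHeavyLowerTail` (stmt-CriticalPhenomena-4575) — hull-port line: SL(3,1) from the functional marker dominance lemma MDL(X)

Support file (prover `prim-ineq-prove-5`; `--supports stmt-CriticalPhenomena-4575`); no definitions, named facts or sorries.
Setting: bond percolation `μ = prodBernoulli w` on a finite vertex type, `C_s = openEdgeCluster · s` (edge cluster),
relays `A`, level `j`, `R_v = {|π(v)| ≤ j}`, observers `x₁, x₂, x₃`, marker `z`.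

`HullPort.selection_triple_of_markerDominance` (companion file) proves the three-observer selection lemma SL(3,1)
from ONE real-number instance `hMDL` of the marker dominance inequality, tested against the signed statistic
`1_{R₂} − 1_{R₁}`, which is not a function of the cluster `C_{x₂}`.  This file replaces that hypothesis by the
FUNCTIONAL marker dominance lemma with an avoided vertex ("MDLX", the cell's shared interface,
memo `run/shared/lean/prim/prim-ineq-prove-5/INBOX.md` 23:2xZ): for every monotone `F : Set (Sym2 V) → ℝ` with
`0 ≤ F ≤ 1`, writing `D = {x₂ ↮ x₁}`, `A₃ = {x₃ ↮ x₁, x₂}`, `Y = {x₂ ↔ x₃}`, `Z = {x₂ ↔ z}`,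
`μ(A₃ ∩ {x₃ ↔ z})·[μ(D) ∫_{D∩Y} F(C_{x₂}) − (∫_D F(C_{x₂})) μ(D ∩ Y)] ≤ μ(A₃)·[μ(D) ∫_{D∩Z} F(C_{x₂}) − (∫_D F(C_{x₂})) μ(D ∩ Z)]`
(`X = ∅` case: `HullPort.markerDominance_noAvoid`, proved; general `X`: proved on paper by prim-hp-7 / prim-lit-3,
HP7-MDLX-PROOF.md, Lean in progress in the cell).

* `HullPort.setIntegral_offCluster_condexp` — the TOWER STEP (van den Berg–Häggström–Kahn's display (10)): on
  `D_X = {s ↮ X}`, for a statistic `H` of the configuration off the cluster (`H(ω ∖ W̄(C_s ω)) = H(ω)` on `D_X`) and any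
  `A : Set (Sym2 V) → ℝ`, `∫_{D_X} A(C_s) H = ∫_{D_X} A(C_s) ψ_H(C_s)` with `ψ_H(W) = Σ_η weight(η) H(η ∖ W̄)`.
* `HullPort.selection_triple_of_markerDominanceAvoid` — SL(3,1) from MDLX: apply MDLX to the monotone function
  `F = (ψ_{R₁} + 1 − r₂)/2` of the cluster (`ψ_{R₁}(W) = E[1_{R₁}(η ∖ W̄)]` is monotone because `R₁` is a decreasing
  event and `W̄` grows with `W`; `r₂(W) = 1{|{t ∈ A : t ∈ V(W)}| ≤ j}` is antitone), and rewrite the three integrals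
  with the tower step; this yields exactly `hMDL`.
[cite: VandenbergHaggstromKahn2005, Thm. 1.3 (p. 6) and §1 pp. 7–8 display (10) — corollaries, derived here]
-/

noncomputable section

namespace Summit.CriticalPhenomena.PercolationContinuityZ3.Theorems

open MeasureTheory Set Literature.Probability.LatticeModels Literature.Probability.Percolation
open scoped Classical

variable {V : Type*}

namespace HullPort

open LonePortSum LonePortSumGeneral BHK2006 DecisionTree KNPreFKG

/-- **Tower step off the cluster** (BHK's display (10)): for `D_X = {s ↮ X}`, any `A : Set (Sym2 V) → ℝ` read on the
cluster `C_s`, and any statistic `H : BondConfig V → ℝ` with the locality property `H(ω ∖ W̄(C_s ω)) = H(ω)` for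
`ω ∈ D_X` (`W̄(W)` = the pairs meeting `{s} ∪ V(W)`),
`∫_{D_X} A(C_s) · H dμ = ∫_{D_X} A(C_s) · ψ_H(C_s) dμ` with `ψ_H(W) = Σ_η weight(η) · H(η ∖ W̄(W))`
("`E[H | C_s = W] = E[H(η ∖ W̄)]` for a fresh configuration `η`").
[cite: VandenbergHaggstromKahn2005, §1 pp. 7–8, display (10) — corollary, derived here] -/
theorem setIntegral_offCluster_condexp [Fintype V] (w : Sym2 V → unitInterval) (s : V) (X : Set V)
    (A : Set (Sym2 V) → ℝ) (H : BondConfig V → ℝ)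
    (hloc : ∀ ω : BondConfig V, (∀ x ∈ X, ¬ (openGraph ω).Reachable s x) →
      H (ω \ {e | ∃ v ∈ e, v = s ∨ ∃ e' ∈ openEdgeCluster ω s, v ∈ e'}) = H ω) :
    ∫ ω in {ω : BondConfig V | ∀ x ∈ X, ¬ (openGraph ω).Reachable s x},
        A (openEdgeCluster ω s) * H ω ∂(prodBernoulli w) =
      ∫ ω in {ω : BondConfig V | ∀ x ∈ X, ¬ (openGraph ω).Reachable s x},
        A (openEdgeCluster ω s) *
          (∑ η, weight (fun e => (w e : ℝ)) η *
            H (η \ {e | ∃ v ∈ e, v = s ∨ ∃ e' ∈ openEdgeCluster ω s, v ∈ e'})) ∂(prodBernoulli w) := by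
  classical
  set DX : Set (BondConfig V) := {ω | ∀ x ∈ X, ¬ (openGraph ω).Reachable s x} with hDX
  set w' : Sym2 V → ℝ := fun e => (w e : ℝ) with hw'
  have hm : ∑ ω, weight w' ω = 1 := by
    have h1 := integral_prodBernoulli_eq_sum w fun _ => (1 : ℝ)
    simp only [integral_const, probReal_univ, smul_eq_mul, mul_one] at h1
    exact h1.symm
  -- `1_{D_X} = NX(C_s)`
  set NX : Set (Sym2 V) → ℝ := fun C => if ∀ x ∈ X, ¬ (x = s ∨ ∃ e ∈ C, x ∈ e) then 1 else 0
    with hNX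
  have hind : ∀ ω : BondConfig V, ind DX ω = NX (openEdgeCluster ω s) := by
    intro ω
    by_cases hω : ω ∈ DX
    · have hω' : ∀ x ∈ X, ¬ (openGraph ω).Reachable s x := hω
      have h1 : ∀ x ∈ X, ¬ (x = s ∨ ∃ e ∈ openEdgeCluster ω s, x ∈ e) := fun x hx h =>
        hω' x hx ((reachable_iff_exists_mem_openEdgeCluster ω s x).2 h)
      rw [ind_of_mem hω, hNX]
      simp only [if_pos h1]
    · have hω' : ∃ x ∈ X, (openGraph ω).Reachable s x := by
        by_contra hcon
        exact hω fun x hx hr => hcon ⟨x, hx, hr⟩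
      obtain ⟨x, hx, hr⟩ := hω'
      have h1 : ¬ ∀ x ∈ X, ¬ (x = s ∨ ∃ e ∈ openEdgeCluster ω s, x ∈ e) := fun h =>
        h x hx ((reachable_iff_exists_mem_openEdgeCluster ω s x).1 hr)
      rw [ind_of_not_mem hω, hNX]
      simp only [if_neg h1]
  have hptw : ∀ ω : BondConfig V, A (openEdgeCluster ω s) * H ω * ind DX ω =
      NX (openEdgeCluster ω s) * A (openEdgeCluster ω s) *
        H (ω \ {e | ∃ v ∈ e, v = s ∨ ∃ e' ∈ openEdgeCluster ω s, v ∈ e'}) := by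
    intro ω
    rw [hind ω]
    by_cases hω : ω ∈ DX
    · rw [hloc ω hω]; ring
    · have h0 : NX (openEdgeCluster ω s) = 0 := by rw [← hind ω, ind_of_not_mem hω]
      rw [h0]; ring
  rw [setIntegral_eq_sum w DX, setIntegral_eq_sum w DX]
  have e2 := sum_cond_cluster_sdiff w' hm s (fun C ξ => NX C * A C * H ξ)
  have lhs : ∑ ω, weight w' ω * (A (openEdgeCluster ω s) * H ω * ind DX ω) =
      ∑ ω, weight w' ω * ((fun C ξ => NX C * A C * H ξ) (openEdgeCluster ω s)
        (ω \ {e | ∃ v ∈ e, v = s ∨ ∃ e' ∈ openEdgeCluster ω s, v ∈ e'})) :=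
    Finset.sum_congr rfl fun ω _ => by simp only; rw [hptw ω]
  rw [lhs, e2]
  refine Finset.sum_congr rfl fun ω _ => ?_
  rw [hind ω]
  simp only [Finset.mul_sum, Finset.sum_mul]
  refine Finset.sum_congr rfl fun η _ => ?_
  ring

/-- **Three-observer selection lemma SL(3,1) from the functional marker dominance lemma MDL(X).**
Observers `x₁, x₂, x₃`, marker `z`, relays `A`, level `j`, `R_v = {|π(v)| ≤ j}`; assume `μ(R₂) ≤ μ(R₁)`,
`μ(R₃) ≤ μ(R₁)` and the functional marker dominance inequality with an avoided vertex for `s = x₂`, `X = {x₁}`,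
`y = x₃`, marker `z` (hypothesis `hMDLX`, quantified over monotone `F : Set (Sym2 V) → ℝ` with `0 ≤ F ≤ 1` and read on the
edge cluster `C_{x₂} = openEdgeCluster · x₂`; with `D = {x₂ ↮ x₁}`, `A₃ = {x₃ ↮ x₂, x₁}`:
`μ(A₃ ∩ {x₃ ↔ z})·[μ(D)∫_{D∩{x₂↔x₃}} F − (∫_D F) μ(D∩{x₂↔x₃})] ≤ μ(A₃)·[μ(D)∫_{D∩{x₂↔z}} F − (∫_D F) μ(D∩{x₂↔z})]`).
Then the selected piece of `U = C(x₁) ∪ C(x₂) ∪ C(x₃)` (the piece of `z` if `z ∈ U`, else that of `x₁`) is light with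
probability at most `μ(R₁)`.  Proof: `hMDL` of `selection_triple_of_markerDominance` is MDLX applied to the monotone
cluster function `F = (ψ_{R₁} + 1 − r₂)/2`, `ψ_{R₁}(W) = E[1_{R₁}(η ∖ W̄)]`, `r₂(W) = 1{|{t ∈ A : t ∈ V(W)}| ≤ j}`, after
the tower step `setIntegral_offCluster_condexp` (`1_{R₁}` is a statistic of the configuration off `C_{x₂}` on `D`).
[cite: VandenbergHaggstromKahn2005, Thm. 1.3 (p. 6), Thm. 1.5 (p. 7), display (10) — corollaries] -/
theorem selection_triple_of_markerDominanceAvoid [Fintype V] (w : Sym2 V → unitInterval) (A : Finset V) (j : ℕ)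
    (x₁ x₂ x₃ z : V) (h12 : x₁ ≠ x₂) (h13 : x₁ ≠ x₃) (h23 : x₂ ≠ x₃)
    (hI2 : (prodBernoulli w).real {ω : BondConfig V | (A.filter fun t => ω ∈ openConn x₂ t).card ≤ j} ≤
      (prodBernoulli w).real {ω : BondConfig V | (A.filter fun t => ω ∈ openConn x₁ t).card ≤ j})
    (hI3 : (prodBernoulli w).real {ω : BondConfig V | (A.filter fun t => ω ∈ openConn x₃ t).card ≤ j} ≤
      (prodBernoulli w).real {ω : BondConfig V | (A.filter fun t => ω ∈ openConn x₁ t).card ≤ j})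
    (hMDLX : ∀ F : Set (Sym2 V) → ℝ, Monotone F → (∀ C, 0 ≤ F C) → (∀ C, F C ≤ 1) →
      (prodBernoulli w).real ({ω : BondConfig V | ∀ x ∈ ({x₂, x₁} : Set V), ¬ (openGraph ω).Reachable x₃ x} ∩
          openConn x₃ z) *
        ((prodBernoulli w).real {ω : BondConfig V | ∀ x ∈ ({x₁} : Set V), ¬ (openGraph ω).Reachable x₂ x} *
            (∫ ω in {ω : BondConfig V | ∀ x ∈ ({x₁} : Set V), ¬ (openGraph ω).Reachable x₂ x} ∩ openConn x₂ x₃,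
              F (openEdgeCluster ω x₂) ∂(prodBernoulli w)) -
          (∫ ω in {ω : BondConfig V | ∀ x ∈ ({x₁} : Set V), ¬ (openGraph ω).Reachable x₂ x},
              F (openEdgeCluster ω x₂) ∂(prodBernoulli w)) *
            (prodBernoulli w).real ({ω : BondConfig V | ∀ x ∈ ({x₁} : Set V), ¬ (openGraph ω).Reachable x₂ x} ∩
              openConn x₂ x₃)) ≤
      (prodBernoulli w).real {ω : BondConfig V | ∀ x ∈ ({x₂, x₁} : Set V), ¬ (openGraph ω).Reachable x₃ x} *
        ((prodBernoulli w).real {ω : BondConfig V | ∀ x ∈ ({x₁} : Set V), ¬ (openGraph ω).Reachable x₂ x} *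
            (∫ ω in {ω : BondConfig V | ∀ x ∈ ({x₁} : Set V), ¬ (openGraph ω).Reachable x₂ x} ∩ openConn x₂ z,
              F (openEdgeCluster ω x₂) ∂(prodBernoulli w)) -
          (∫ ω in {ω : BondConfig V | ∀ x ∈ ({x₁} : Set V), ¬ (openGraph ω).Reachable x₂ x},
              F (openEdgeCluster ω x₂) ∂(prodBernoulli w)) *
            (prodBernoulli w).real ({ω : BondConfig V | ∀ x ∈ ({x₁} : Set V), ¬ (openGraph ω).Reachable x₂ x} ∩
              openConn x₂ z))) :
    (prodBernoulli w).real {ω : BondConfig V |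
        ((ω ∈ openConn z x₁ ∨ ω ∈ openConn z x₂ ∨ ω ∈ openConn z x₃) ∧
          (A.filter fun t => ω ∈ openConn z t).card ≤ j) ∨
        (ω ∉ openConn z x₁ ∧ ω ∉ openConn z x₂ ∧ ω ∉ openConn z x₃ ∧
          (A.filter fun t => ω ∈ openConn x₁ t).card ≤ j)} ≤
      (prodBernoulli w).real {ω : BondConfig V | (A.filter fun t => ω ∈ openConn x₁ t).card ≤ j} := by
  classical
  set μ := prodBernoulli w with hμ
  set w' : Sym2 V → ℝ := fun e => (w e : ℝ) with hw'
  have hw0 : ∀ e, 0 ≤ w' e := fun e => (w e).2.1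
  have hw1 : ∀ e, w' e ≤ 1 := fun e => (w e).2.2
  have hm : ∑ ω, weight w' ω = 1 := by
    have h1 := integral_prodBernoulli_eq_sum w fun _ => (1 : ℝ)
    simp only [integral_const, probReal_univ, smul_eq_mul, mul_one] at h1
    exact h1.symm
  set R1 : Set (BondConfig V) := {ω | (A.filter fun t => ω ∈ openConn x₁ t).card ≤ j} with hR1
  set R2 : Set (BondConfig V) := {ω | (A.filter fun t => ω ∈ openConn x₂ t).card ≤ j} with hR2
  set DX : Set (BondConfig V) := {ω | ∀ x ∈ ({x₁} : Set V), ¬ (openGraph ω).Reachable x₂ x} with hDX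
  set A3 : Set (BondConfig V) := {ω | ∀ x ∈ ({x₂, x₁} : Set V), ¬ (openGraph ω).Reachable x₃ x} with hA3
  set Z2 : Set (BondConfig V) := openConn x₂ z with hZ2
  set X32 : Set (BondConfig V) := openConn x₂ x₃ with hX32
  set bar : Set (Sym2 V) → Set (Sym2 V) := fun W => {e | ∃ v ∈ e, v = x₂ ∨ ∃ e' ∈ W, v ∈ e'} with hbar
  -- the two set identities relating the MDLX events to those of `selection_triple_of_markerDominance`
  have hDXeq : DX = (openConn x₁ x₂ : Set (BondConfig V))ᶜ := by
    ext ω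
    simp only [hDX, Set.mem_setOf_eq, Set.mem_singleton_iff, forall_eq, Set.mem_compl_iff, openConn]
    exact ⟨fun h h' => h h'.symm, fun h h' => h h'.symm⟩
  have hA3eq : A3 = {ω : BondConfig V | ∀ x ∈ ({x₁, x₂} : Set V), ¬ (openGraph ω).Reachable x₃ x} := by
    ext ω
    simp only [hA3, Set.mem_setOf_eq, Set.mem_insert_iff, Set.mem_singleton_iff, forall_eq_or_imp, forall_eq]
    exact ⟨fun h => ⟨h.2, h.1⟩, fun h => ⟨h.2, h.1⟩⟩
  -- `R₁` is a decreasing event, read off the cluster of `x₂` on `D`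
  have R1_anti : ∀ ω ω' : BondConfig V, ω' ⊆ ω → ω ∈ R1 → ω' ∈ R1 := by
    intro ω ω' hsub hω
    have hsub' : (A.filter fun t => ω' ∈ openConn x₁ t) ⊆ (A.filter fun t => ω ∈ openConn x₁ t) := by
      intro t ht
      rw [Finset.mem_filter] at ht ⊢
      exact ⟨ht.1, (ht.2 : (openGraph ω').Reachable x₁ t).mono (openGraph_le hsub)⟩
    exact le_trans (Finset.card_le_card hsub') hω
  have hloc : ∀ ω : BondConfig V, (∀ x ∈ ({x₁} : Set V), ¬ (openGraph ω).Reachable x₂ x) →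
      ind R1 (ω \ {e | ∃ v ∈ e, v = x₂ ∨ ∃ e' ∈ openEdgeCluster ω x₂, v ∈ e'}) = ind R1 ω := by
    intro ω hω
    have hx : ¬ (openGraph ω).Reachable x₂ x₁ := hω x₁ rfl
    have hiff : (ω \ {e | ∃ v ∈ e, v = x₂ ∨ ∃ e' ∈ openEdgeCluster ω x₂, v ∈ e'}) ∈ R1 ↔ ω ∈ R1 := by
      have hfe : (A.filter fun t =>
            (ω \ {e | ∃ v ∈ e, v = x₂ ∨ ∃ e' ∈ openEdgeCluster ω x₂, v ∈ e'}) ∈ openConn x₁ t) =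
          (A.filter fun t => ω ∈ openConn x₁ t) :=
        Finset.filter_congr fun t _ => reachable_sdiff_bar_iff hx t
      simp only [hR1, Set.mem_setOf_eq, hfe]
    by_cases h : ω ∈ R1
    · rw [ind_of_mem h, ind_of_mem (hiff.2 h)]
    · rw [ind_of_not_mem h, ind_of_not_mem fun h' => h (hiff.1 h')]
  -- the conditional mean `ψ(W) = E[1_{R₁}(η ∖ W̄)]`, monotone with values in `[0,1]`
  set ψ : Set (Sym2 V) → ℝ := fun W => ∑ η, weight w' η * ind R1 (η \ bar W) with hψ
  have hψmono : Monotone ψ := by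
    intro W W' hWW'
    refine Finset.sum_le_sum fun η _ => mul_le_mul_of_nonneg_left ?_ (weight_nonneg hw0 hw1 η)
    have hsub : η \ bar W' ⊆ η \ bar W := Set.sdiff_subset_sdiff_right (bar_mono x₂ hWW')
    by_cases h : η \ bar W ∈ R1
    · rw [ind_of_mem h, ind_of_mem (R1_anti _ _ hsub h)]
    · rw [ind_of_not_mem h]; exact ind_nonneg _ _
  have hψ0 : ∀ W, 0 ≤ ψ W := fun W =>
    Finset.sum_nonneg fun η _ => mul_nonneg (weight_nonneg hw0 hw1 η) (ind_nonneg _ _)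
  have hψ1 : ∀ W, ψ W ≤ 1 := by
    intro W
    calc ψ W ≤ ∑ η, weight w' η * 1 :=
          Finset.sum_le_sum fun η _ => mul_le_mul_of_nonneg_left (ind_le_one _ _) (weight_nonneg hw0 hw1 η)
      _ = 1 := by simp [hm]
  -- cluster-side indicators: `r₂(C_{x₂}) = 1_{R₂}`, `ζ(C_{x₂}) = 1_{Z}`, `υ(C_{x₂}) = 1_{Y}`
  set r2 : Set (Sym2 V) → ℝ := fun C =>
    if (A.filter fun t => (t = x₂ ∨ ∃ e ∈ C, t ∈ e)).card ≤ j then 1 else 0 with hr2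
  have hr2anti : Antitone r2 := by
    intro C C' hCC'
    have hsub : (A.filter fun t => (t = x₂ ∨ ∃ e ∈ C, t ∈ e)) ⊆
        (A.filter fun t => (t = x₂ ∨ ∃ e ∈ C', t ∈ e)) := by
      intro t ht
      rw [Finset.mem_filter] at ht ⊢
      exact ⟨ht.1, ht.2.imp id fun ⟨e, he, hte⟩ => ⟨e, hCC' he, hte⟩⟩
    simp only [hr2]
    by_cases h' : (A.filter fun t => (t = x₂ ∨ ∃ e ∈ C', t ∈ e)).card ≤ j
    · rw [if_pos h', if_pos (le_trans (Finset.card_le_card hsub) h')]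
    · rw [if_neg h']; split_ifs <;> norm_num
  have hr2eq : ∀ ω : BondConfig V, r2 (openEdgeCluster ω x₂) = ind R2 ω := by
    intro ω
    have hfe : (A.filter fun t => (t = x₂ ∨ ∃ e ∈ openEdgeCluster ω x₂, t ∈ e)) =
        (A.filter fun t => ω ∈ openConn x₂ t) :=
      Finset.filter_congr fun t _ => (reachable_iff_exists_mem_openEdgeCluster ω x₂ t).symm
    by_cases h : ω ∈ R2
    · have h' : (A.filter fun t => ω ∈ openConn x₂ t).card ≤ j := h
      rw [ind_of_mem h, hr2]; simp only [hfe, if_pos h']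
    · have h' : ¬ (A.filter fun t => ω ∈ openConn x₂ t).card ≤ j := h
      rw [ind_of_not_mem h, hr2]; simp only [hfe, if_neg h']
  set ζ : Set (Sym2 V) → ℝ := fun C => if (z = x₂ ∨ ∃ e ∈ C, z ∈ e) then 1 else 0 with hζ
  have hζeq : ∀ ω : BondConfig V, ζ (openEdgeCluster ω x₂) = ind Z2 ω := by
    intro ω
    by_cases h : ω ∈ Z2
    · rw [ind_of_mem h, hζ]
      simp only [if_pos ((reachable_iff_exists_mem_openEdgeCluster ω x₂ z).1 h)]
    · rw [ind_of_not_mem h, hζ]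
      have h' : ¬ (z = x₂ ∨ ∃ e ∈ openEdgeCluster ω x₂, z ∈ e) := fun hh =>
        h ((reachable_iff_exists_mem_openEdgeCluster ω x₂ z).2 hh)
      simp only [if_neg h']
  set υ : Set (Sym2 V) → ℝ := fun C => if (x₃ = x₂ ∨ ∃ e ∈ C, x₃ ∈ e) then 1 else 0 with hυ
  have hυeq : ∀ ω : BondConfig V, υ (openEdgeCluster ω x₂) = ind X32 ω := by
    intro ω
    by_cases h : ω ∈ X32
    · rw [ind_of_mem h, hυ]
      simp only [if_pos ((reachable_iff_exists_mem_openEdgeCluster ω x₂ x₃).1 h)]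
    · rw [ind_of_not_mem h, hυ]
      have h' : ¬ (x₃ = x₂ ∨ ∃ e ∈ openEdgeCluster ω x₂, x₃ ∈ e) := fun hh =>
        h ((reachable_iff_exists_mem_openEdgeCluster ω x₂ x₃).2 hh)
      simp only [if_neg h']
  -- the test function
  set F : Set (Sym2 V) → ℝ := fun C => (ψ C + (1 - r2 C)) / 2 with hF
  have hFmono : Monotone F := fun C C' h => by
    simp only [hF]
    have := hψmono h; have := hr2anti h
    linarith
  have hF0 : ∀ C, 0 ≤ F C := fun C => by
    simp only [hF]
    have := hψ0 C
    have : r2 C ≤ 1 := by simp only [hr2]; split_ifs <;> norm_num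
    linarith
  have hF1 : ∀ C, F C ≤ 1 := fun C => by
    simp only [hF]
    have := hψ1 C
    have : 0 ≤ r2 C := by simp only [hr2]; split_ifs <;> norm_num
    linarith
  -- integrals of `F(C_{x₂})` against a cluster-side indicator `g`
  have key : ∀ (G : Set (BondConfig V)) (g : Set (Sym2 V) → ℝ),
      (∀ ω : BondConfig V, g (openEdgeCluster ω x₂) = ind G ω) →
      ∫ ω in DX ∩ G, F (openEdgeCluster ω x₂) ∂μ =
        (μ.real (DX ∩ G ∩ R1) + μ.real (DX ∩ G) - μ.real (DX ∩ G ∩ R2)) / 2 := by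
    intro G g hg
    -- `∫_{D∩G} F = ∫_D g(C) F(C)`
    have e1 : ∫ ω in DX ∩ G, F (openEdgeCluster ω x₂) ∂μ =
        ∫ ω in DX, g (openEdgeCluster ω x₂) * F (openEdgeCluster ω x₂) ∂μ := by
      rw [setIntegral_eq_sum w (DX ∩ G), setIntegral_eq_sum w DX]
      refine Finset.sum_congr rfl fun ω _ => ?_
      rw [ind_inter, hg ω]; ring
    -- tower step for the `ψ` part
    have e2 : ∫ ω in DX, g (openEdgeCluster ω x₂) * ind R1 ω ∂μ =
        ∫ ω in DX, g (openEdgeCluster ω x₂) * ψ (openEdgeCluster ω x₂) ∂μ :=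
      setIntegral_offCluster_condexp w x₂ ({x₁} : Set V) g (ind R1) hloc
    have e3 : ∫ ω in DX, g (openEdgeCluster ω x₂) * ind R1 ω ∂μ = μ.real (DX ∩ G ∩ R1) := by
      rw [setIntegral_eq_sum w DX, measureReal_eq_sum w]
      refine Finset.sum_congr rfl fun ω _ => ?_
      simp only [ind_inter]; rw [hg ω]; ring
    have e4 : ∫ ω in DX, g (openEdgeCluster ω x₂) * F (openEdgeCluster ω x₂) ∂μ =
        ((∫ ω in DX, g (openEdgeCluster ω x₂) * ψ (openEdgeCluster ω x₂) ∂μ) +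
          μ.real (DX ∩ G) - μ.real (DX ∩ G ∩ R2)) / 2 := by
      rw [setIntegral_eq_sum w DX, setIntegral_eq_sum w DX, measureReal_eq_sum w, measureReal_eq_sum w,
        ← Finset.sum_add_distrib, ← Finset.sum_sub_distrib, Finset.sum_div]
      refine Finset.sum_congr rfl fun ω _ => ?_
      simp only [ind_inter]
      rw [← hg ω, ← hr2eq ω, hF]
      ring
    rw [e1, e4, ← e2, e3]
  have hind1 : ∀ ω : BondConfig V, (fun _ : Set (Sym2 V) => (1 : ℝ)) (openEdgeCluster ω x₂) = ind Set.univ ω :=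
    fun ω => by simp only [ind_of_mem (Set.mem_univ ω)]
  have kD := key Set.univ (fun _ => 1) hind1
  have kZ := key Z2 ζ hζeq
  have kY := key X32 υ hυeq
  simp only [Set.inter_univ] at kD
  -- MDLX for `F`, rewritten
  have h := hMDLX F hFmono hF0 hF1
  change μ.real (A3 ∩ openConn x₃ z) * (μ.real DX * (∫ ω in DX ∩ X32, F (openEdgeCluster ω x₂) ∂μ) -
      (∫ ω in DX, F (openEdgeCluster ω x₂) ∂μ) * μ.real (DX ∩ X32)) ≤
    μ.real A3 * (μ.real DX * (∫ ω in DX ∩ Z2, F (openEdgeCluster ω x₂) ∂μ) -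
      (∫ ω in DX, F (openEdgeCluster ω x₂) ∂μ) * μ.real (DX ∩ Z2)) at h
  rw [kD, kZ, kY] at h
  refine selection_triple_of_markerDominance w A j x₁ x₂ x₃ z h12 h13 h23 hI2 hI3 ?_
  rw [← hA3eq, ← hDXeq]
  change μ.real A3 * (μ.real DX * (μ.real (DX ∩ Z2 ∩ R2) - μ.real (DX ∩ Z2 ∩ R1)) -
      (μ.real (DX ∩ R2) - μ.real (DX ∩ R1)) * μ.real (DX ∩ Z2)) ≤
    μ.real (A3 ∩ openConn x₃ z) * (μ.real DX * (μ.real (DX ∩ X32 ∩ R2) - μ.real (DX ∩ X32 ∩ R1)) -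
      (μ.real (DX ∩ R2) - μ.real (DX ∩ R1)) * μ.real (DX ∩ X32))
  linear_combination (2 : ℝ) * h

end HullPort

end Summit.CriticalPhenomena.PercolationContinuityZ3.Theorems
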